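import Literature.Geometry.Lorentzian.SpacetimePointPushConvergence
import HarnessLib

/-!
# Translates of a spacetime based at points converging to `x₀` converge to `(𝓢, x₀)`
(topic `Geometry/Lorentzian`; the POINT-PUSHING DATUM for pointed `Cᵏ_loc` convergence,
`SpacetimeLocalConvergence.lean`; Petersen 2006, Ch. 10, §3.2; Hirsch 1976, Ch. 8 §3 and
Milnor 1965, §4 (homogeneity: points are moved by diffeomorphisms close to the identity))

**Theorem (`LocalSubconvergence.ofTendsto`, `SubconvergesLocallyTo.ofTendsto`).** For a spacetime
`𝓢`, a point `x₀` and ANY sequence of points `x m → x₀`, the pointed spacetimes `(𝓢, x m)`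
converge to `(𝓢, x₀)` in the pointed `Cᵏ_loc` sense, for every `k`: the comparison maps are the
point pushes `ψₘ = P.push (c (x m) − c x₀)` of a push datum at `x₀` (diffeomorphisms of `𝓢`
supported in a fixed compact chart ball, moving `x₀` to `x m`, converging to the identity), the
exhaustion is the standard one of `LocalSubconvergence.refl`, and the two analytic clauses are
`eventually_isFutureDirected_mfderiv_push` and `tendsto_supCkENorm_metricInCoords_push_sub`
(`SpacetimePointPushConvergence.lean`). The constant sequence (`x m = x₀`) recovers
`LocalSubconvergence.refl` up to the choice of comparison maps.

Consequence (with `LocalSubconvergence.trans`, `SpacetimeLocalConvergenceTrans.lean`): pointed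
`Cᵏ_loc` limits are insensitive to replacing the base points of the limit by any sequence converging
to the base point — the BASE-POINT ADJUSTMENT used by hull / limit-set arguments
(`SpacetimeLocalConvergenceAdjust.lean`).

## References
* [Petersen2006] P. Petersen, *Riemannian Geometry*, 2nd ed., GTM 171, Springer 2006, Ch. 10, §3.2.
* [Hirsch1976] M. W. Hirsch, *Differential Topology*, GTM 33, Springer 1976, Ch. 8, §3.
-/

noncomputable section

open TopologicalSpace Manifold Filter Topology Set Function Metric
open scoped ContDiff Topology ENNReal NNReal

universe u

namespace Literature.Geometry.Lorentzian

namespace Spacetime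

namespace LocalSubconvergence

variable (𝓢 : Spacetime.{u} 4) {x₀ : 𝓢.carrier} {x : ℕ → 𝓢.carrier}
  (hx : Tendsto x atTop (𝓝 x₀)) (k : ℕ)

/-- The push vectors `c (x m) − c x₀` tend to `0`. [folklore] -/
theorem tendsto_chart_sub (hx : Tendsto x atTop (𝓝 x₀)) :
    Tendsto (fun m ↦ chartAt E4 x₀ (x m) - chartAt E4 x₀ x₀) atTop (𝓝 0) := by
  have hc : Tendsto (fun m ↦ chartAt E4 x₀ (x m)) atTop (𝓝 (chartAt E4 x₀ x₀)) :=
    ((chartAt E4 x₀).continuousAt (mem_chart_source E4 x₀)).tendsto.comp hx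
  have h := hc.sub_const (chartAt E4 x₀ x₀)
  rwa [sub_self] at h

/-- **The good indices**: eventually `x m` lies in the chart source, the push vector is admissible
and the push preserves the time orientation everywhere. [folklore] -/
theorem eventually_pushGood (hx : Tendsto x atTop (𝓝 x₀)) :
    ∀ᶠ m in atTop, x m ∈ (chartAt E4 x₀).source ∧
      (pushData 𝓢 x₀).Admissible (chartAt E4 x₀ (x m) - chartAt E4 x₀ x₀) ∧
        ∀ q : 𝓢.carrier, 𝓢.timeOrientation.IsFutureDirected
          (mfderiv (𝓡 4) (𝓡 4) ((pushData 𝓢 x₀).push (chartAt E4 x₀ (x m) - chartAt E4 x₀ x₀)) q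
            (𝓢.timeOrientation.vectorField q)) := by
  have hv := tendsto_chart_sub 𝓢 hx
  have h1 : ∀ᶠ m in atTop, x m ∈ (chartAt E4 x₀).source :=
    hx.eventually ((chartAt E4 x₀).open_source.mem_nhds (mem_chart_source E4 x₀))
  have h2 := hv.eventually (pushData 𝓢 x₀).eventually_admissible
  have h3 := hv.eventually (pushData 𝓢 x₀).eventually_isFutureDirected_mfderiv_push
  filter_upwards [h1, h2, h3] with m hm1 hm2 hm3
  exact ⟨hm1, hm2, hm3⟩

/-- Existence of a threshold beyond which all indices are good. [folklore] -/
theorem exists_pushShift (hx : Tendsto x atTop (𝓝 x₀)) : ∃ m₀ : ℕ, ∀ m, m₀ ≤ m →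
    x m ∈ (chartAt E4 x₀).source ∧
      (pushData 𝓢 x₀).Admissible (chartAt E4 x₀ (x m) - chartAt E4 x₀ x₀) ∧
        ∀ q : 𝓢.carrier, 𝓢.timeOrientation.IsFutureDirected
          (mfderiv (𝓡 4) (𝓡 4) ((pushData 𝓢 x₀).push (chartAt E4 x₀ (x m) - chartAt E4 x₀ x₀)) q
            (𝓢.timeOrientation.vectorField q)) :=
  eventually_atTop.1 (eventually_pushGood 𝓢 hx)

/-- The **index shift** of the point-pushing datum. [folklore] -/
def pushShift (hx : Tendsto x atTop (𝓝 x₀)) : ℕ := Classical.choose (exists_pushShift 𝓢 hx)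

/-- Beyond the shift every index is good. [folklore] -/
theorem pushShift_spec (hx : Tendsto x atTop (𝓝 x₀)) (m : ℕ) :
    x (m + pushShift 𝓢 hx) ∈ (chartAt E4 x₀).source ∧
      (pushData 𝓢 x₀).Admissible (chartAt E4 x₀ (x (m + pushShift 𝓢 hx)) - chartAt E4 x₀ x₀) ∧
        ∀ q : 𝓢.carrier, 𝓢.timeOrientation.IsFutureDirected
          (mfderiv (𝓡 4) (𝓡 4) ((pushData 𝓢 x₀).push
            (chartAt E4 x₀ (x (m + pushShift 𝓢 hx)) - chartAt E4 x₀ x₀)) q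
            (𝓢.timeOrientation.vectorField q)) :=
  Classical.choose_spec (exists_pushShift 𝓢 hx) _ (Nat.le_add_left _ _)

/-- The **push vectors** of the datum. [folklore] -/
def pushVec (hx : Tendsto x atTop (𝓝 x₀)) (m : ℕ) : E4 :=
  chartAt E4 x₀ (x (m + pushShift 𝓢 hx)) - chartAt E4 x₀ x₀

/-- The push vectors tend to `0`. [folklore] -/
theorem tendsto_pushVec (hx : Tendsto x atTop (𝓝 x₀)) : Tendsto (pushVec 𝓢 hx) atTop (𝓝 0) :=
  (tendsto_chart_sub 𝓢 hx).comp (tendsto_add_atTop_nat _)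

/-- The **comparison maps** of the datum: the point pushes. [cite: Hirsch1976, Ch. 8 §3] -/
def pushEmbed (hx : Tendsto x atTop (𝓝 x₀)) (m : ℕ) : 𝓢.carrier → 𝓢.carrier :=
  (pushData 𝓢 x₀).push (pushVec 𝓢 hx m)

/-- **The point-pushing datum**: `(𝓢, x m) ⇀ (𝓢, x₀)` in the pointed `Cᵏ_loc` sense for EVERY
sequence `x m → x₀` (module docstring). [cite: Petersen2006, Ch. 10 §3.2] -/
def ofTendsto (hx : Tendsto x atTop (𝓝 x₀)) (k : ℕ) : LocalSubconvergence (fun _ ↦ 𝓢) x 𝓢 x₀ k where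
  sub := fun m ↦ m + pushShift 𝓢 hx
  strictMono_sub := strictMono_id.add_const _
  U := (LocalSubconvergence.refl 𝓢 x₀ k).U
  monotone_U := (LocalSubconvergence.refl 𝓢 x₀ k).monotone_U
  mem_U := (LocalSubconvergence.refl 𝓢 x₀ k).mem_U
  iUnion_U := (LocalSubconvergence.refl 𝓢 x₀ k).iUnion_U
  isCompact_closure_U := (LocalSubconvergence.refl 𝓢 x₀ k).isCompact_closure_U
  embed := pushEmbed 𝓢 hx
  isLocalDiffeomorphOn_embed := fun m ↦
    ((pushData 𝓢 x₀).isLocalDiffeomorph_push (pushShift_spec 𝓢 hx m).2.1).isLocalDiffeomorphOn _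
  injOn_embed := fun m ↦ ((pushData 𝓢 x₀).injective_push (pushShift_spec 𝓢 hx m).2.1).injOn
  embed_basepoint := fun m ↦
    (pushData 𝓢 x₀).push_apply_basepoint_of_mem (pushShift_spec 𝓢 hx m).1
  isFutureDirected_mfderiv_embed := fun m q _ ↦ (pushShift_spec 𝓢 hx m).2.2 q
  tendsto_supCkENorm := fun x' _ hK hKt ↦
    ((pushData 𝓢 x₀).tendsto_supCkENorm_metricInCoords_push_sub x' hK hKt k).comp
      (tendsto_pushVec 𝓢 hx)

/-- The comparison maps of `ofTendsto` are the point pushes. [folklore] -/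
theorem ofTendsto_embed (hx : Tendsto x atTop (𝓝 x₀)) (k m : ℕ) :
    (ofTendsto 𝓢 hx k).embed m = (pushData 𝓢 x₀).push (pushVec 𝓢 hx m) := rfl

/-- The subsequence of `ofTendsto` is the shift. [folklore] -/
theorem ofTendsto_sub (hx : Tendsto x atTop (𝓝 x₀)) (k m : ℕ) :
    (ofTendsto 𝓢 hx k).sub m = m + pushShift 𝓢 hx := rfl

/-- Off the compact support set of the push datum, every comparison map of `ofTendsto` is the
identity. [folklore] -/
theorem ofTendsto_embed_eq_self {hx : Tendsto x atTop (𝓝 x₀)} {k m : ℕ} {q : 𝓢.carrier}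
    (hq : q ∉ (pushData 𝓢 x₀).supportSet) : (ofTendsto 𝓢 hx k).embed m q = q :=
  (pushData 𝓢 x₀).push_eq_self_of_not_mem hq

end LocalSubconvergence

/-- **Translates at converging base points converge** (`Prop` level): for every sequence
`x m → x₀` in a spacetime `𝓢`, `(𝓢, x m) ⇀ (𝓢, x₀)` in the pointed `Cᵏ_loc` sense. [cite: Petersen2006, Ch. 10 §3.2] -/
theorem SubconvergesLocallyTo.ofTendsto (𝓢 : Spacetime.{u} 4) {x₀ : 𝓢.carrier}
    {x : ℕ → 𝓢.carrier} (hx : Tendsto x atTop (𝓝 x₀)) (k : ℕ) :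
    SubconvergesLocallyTo (fun _ ↦ 𝓢) x 𝓢 x₀ k :=
  ⟨LocalSubconvergence.ofTendsto 𝓢 hx k⟩

end Spacetime

end Literature.Geometry.Lorentzian
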